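import Summits.Ventures.PercRepro.RankLevelSetUpFiveTargetsA
import Summits.Ventures.PercRepro.RankLevelSetUpFiveBad

/-! # RankLevelSetUpFiveBadA — THE TYPE-A TARGET OF A BAD MEMBER, READ IN `M` (night-1 g41; dossier §53.4; on
`RankLevelSetUpFiveTargetsA` and `RankLevelSetUpFiveBad`)

The second target shape of the charging of §53, transported to `M`: for a bad member `W ∈ T_5(b)` (`c₀ W = 3`,
`C` the coloops of `M✶|(E ∖ W)`, `L' := (E ∖ W) ∖ C` the line) with the marked element ON the line
(`b ∈ cl✶ L'`), every pair `ℓ ≠ ℓ'` of `L'` with `{ℓ, ℓ'} ⊄ cl✶ (W ∖ b)` gives `Z := (W ∖ b) ∪ {ℓ, ℓ'} ∈ biIndep M 6`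
avoiding `b`, and every `t ∈ C` lies in `{t ∈ (E ∖ Z) ∖ {b} : t ∈ cl_M Z}` (**`typeA_target_mem_avoid`**) — the
transport of `typeA_target_valid`. Every declaration has a docstring; imports: the cell's own modules and Mathlib
only. Axioms: standard. -/

namespace PercRepro

open Set Matroid

variable {α : Type} (M : Matroid α) [M.Finite]

/-- **THE TYPE-A TARGET OF A BAD MEMBER IS A MEMBER OF `V_6(b)` WHOSE COLOOP COUNT SEES EVERY `t ∈ C`** (night-1
g41, §53.4): `M` coloop-free, without a series triple, of nullity `5`, with `≥ 12` elements; `W ∈ biIndep M 5`,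
`b ∈ W`, `C := {t ∈ E ∖ W : t ∈ cl_M W}` of three elements, `L' := (E ∖ W) ∖ C`, `b ∈ cl✶ L'`; `ℓ ≠ ℓ'` in `L'` with
`{ℓ, ℓ'} ⊄ cl✶ (W ∖ b)`. Then `Z := (W ∖ b) ∪ {ℓ, ℓ'}` is in `biIndep M 6`, avoids `b`, and every `t ∈ C` lies in
`{t ∈ (E ∖ Z) ∖ {b} : t ∈ cl_M Z}`. -/
theorem typeA_target_mem_avoid (hν : M✶.eRank = 5) (hcol : ∀ e, ¬ M.IsColoop e) (hnt : NoSeriesTriple M)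
    (hn : 12 ≤ M.E.ncard) {W : Set α} (hW : W ∈ biIndep M 5) {b : α} (hb : b ∈ W)
    (hC3 : {t ∈ M.E \ W | t ∈ M.closure W}.ncard = 3)
    (hbL : b ∈ M✶.closure ((M.E \ W) \ {t ∈ M.E \ W | t ∈ M.closure W})) {ℓ ℓ' : α}
    (hℓ : ℓ ∈ (M.E \ W) \ {t ∈ M.E \ W | t ∈ M.closure W})
    (hℓ' : ℓ' ∈ (M.E \ W) \ {t ∈ M.E \ W | t ∈ M.closure W}) (hne : ℓ ≠ ℓ')
    (hZ : ¬ ({ℓ, ℓ'} ⊆ M✶.closure (W \ {b}))) :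
    (W \ {b}) ∪ {ℓ, ℓ'} ∈ biIndep M 6 ∧ b ∉ (W \ {b}) ∪ {ℓ, ℓ'} ∧
      ∀ t ∈ {t ∈ M.E \ W | t ∈ M.closure W},
        t ∈ {t ∈ (M.E \ ((W \ {b}) ∪ {ℓ, ℓ'})) \ {b} | t ∈ M.closure ((W \ {b}) ∪ {ℓ, ℓ'})} := by
  classical
  set C := {t ∈ M.E \ W | t ∈ M.closure W} with hCdef
  set L' := (M.E \ W) \ C with hL'def
  set Z := (W \ {b}) ∪ {ℓ, ℓ'} with hZdef
  have hWE : W ⊆ M.E := hW.1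
  have hCY : C ⊆ M.E \ W := fun t ht => ht.1
  -- the dual data
  have hnl : ∀ e ∈ M✶.E, M✶.IsNonloop e := fun e he =>
    dual_isNonloop_of_coloopFree M hcol (by rwa [Matroid.dual_ground] at he)
  have hnt' := dual_no_parallel_triple M hcol hnt
  have hWB : M✶.IsBase W := isBase_dual_of_mem_biIndep_five M hν hW
  have hY : M✶.E \ W = C ∪ L' := by
    rw [Matroid.dual_ground, hL'def, Set.union_sdiff_cancel hCY]
  have hdj : Disjoint C L' := Set.disjoint_sdiff_right
  have hL2 : M✶.eRk L' ≤ 2 := bad_line_eRk_le_two M hν.le hW hC3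
  have hL4 : 4 ≤ L'.ncard := by rw [hL'def, bad_line_ncard M hW hC3]; omega
  have hYsp : M✶.Spanning (C ∪ L') := by
    rw [← hY, Matroid.dual_ground]; exact dual_spanning_compl_of_indep M hW.2.2.1
  obtain ⟨hZsp, hEZsp, hcolZ⟩ :=
    typeA_target_valid hν hnl hnt' hWB hb hY hdj hL2 hL4 hC3 hbL hYsp hℓ hℓ' hne hZ
  -- membership facts
  have hℓE : ℓ ∈ M.E := hℓ.1.1
  have hℓ'E : ℓ' ∈ M.E := hℓ'.1.1
  have hℓW : ℓ ∉ W := hℓ.1.2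
  have hℓ'W : ℓ' ∉ W := hℓ'.1.2
  have hbℓ : b ≠ ℓ := fun h => hℓW (h ▸ hb)
  have hbℓ' : b ≠ ℓ' := fun h => hℓ'W (h ▸ hb)
  have hZE : Z ⊆ M.E := by
    intro x hx
    rcases hx with hx | hx
    · exact hWE hx.1
    · rcases hx with rfl | rfl
      · exact hℓE
      · exact hℓ'E
  have hbZ : b ∉ Z := by
    rintro (h | h)
    · exact h.2 rfl
    · rcases h with h | h
      · exact hbℓ h
      · exact hbℓ' h
  -- the cardinality of `Z`
  have hWfin : W.Finite := M.ground_finite.subset hWE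
  have hZcard : Z.ncard = 6 := by
    have h1 : (W \ {b}).ncard = 4 := by rw [Set.ncard_sdiff_singleton_of_mem hb, hW.2.1]
    have hℓ'W' : ℓ' ∉ W \ {b} := fun h => hℓ'W h.1
    have hℓW' : ℓ ∉ insert ℓ' (W \ {b}) := by
      rintro (h | h)
      · exact hne h
      · exact hℓW h.1
    have e : Z = insert ℓ (insert ℓ' (W \ {b})) := by
      rw [hZdef]; ext x
      simp only [Set.mem_union, Set.mem_insert_iff, Set.mem_singleton_iff]; tauto
    rw [e, Set.ncard_insert_of_notMem hℓW' ((hWfin.sdiff).insert ℓ'),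
      Set.ncard_insert_of_notMem hℓ'W' hWfin.sdiff, h1]
  -- `Z ∈ biIndep M 6`
  have hZmem : Z ∈ biIndep M 6 := by
    refine ⟨hZE, hZcard, ?_, ?_⟩
    · exact indep_of_dual_spanning_compl M hZE (by rw [← Matroid.dual_ground] at hEZsp ⊢; exact hEZsp)
    · refine indep_of_dual_spanning_compl M Set.sdiff_subset ?_
      rw [Set.sdiff_sdiff_cancel_left hZE]
      exact hZsp
  refine ⟨hZmem, hbZ, ?_⟩
  intro t htC
  have htE : t ∈ M.E := htC.1.1
  have htW : t ∉ W := htC.1.2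
  have htℓ : t ≠ ℓ := fun h => hℓ.2 (h ▸ htC)
  have htℓ' : t ≠ ℓ' := fun h => hℓ'.2 (h ▸ htC)
  have htb : t ≠ b := fun h => htW (h ▸ hb)
  have htZ : t ∉ Z := by
    rintro (h | h)
    · exact htW h.1
    · rcases h with h | h
      · exact htℓ h
      · exact htℓ' h
  have htEZ : t ∈ M.E \ Z := ⟨htE, htZ⟩
  -- `t ∈ cl_M Z` through the dual reading of the closure
  have hdual := compl_closure_eq_dual_coloops M hZmem
  have hnot : ¬ M✶.Spanning ((M✶.E \ Z) \ {t}) := hcolZ t htC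
  have hEZ' : M✶.E \ Z = M.E \ Z := by rw [Matroid.dual_ground]
  rw [hEZ'] at hnot hEZsp
  have htcl : t ∉ M✶.closure ((M.E \ Z) \ {t}) := fun h =>
    hnot ((spanning_sdiff_singleton_iff hEZsp htEZ).mpr h)
  have hmem : t ∈ {t ∈ M.E \ Z | t ∈ M.closure Z} := by rw [hdual]; exact ⟨htEZ, htcl⟩
  exact ⟨⟨htEZ, by rw [Set.mem_singleton_iff]; exact htb⟩, hmem.2⟩

end PercRepro
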